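import Summits.QuantumFields.BalabanUV.Beta.D1BFx.AveragingJetNeedle
import Summits.QuantumFields.BalabanUV.Beta.D1BFx.GhostStencilRooted

/-!
# `BalabanUV.Beta.D1BFx.NeedleBondMarginal` — road «BF-x» for binder row D1, slot (K), END row `hGrp gN` (NEEDLES ∪ G_R), (N-1) letter
# M7 of an3-g56's NEEDLE-PROFILES memo = M1 of an1-g37's: THE BOND-INDEX `ℓ¹` (BOND MARGINAL) OF THE AXIAL-CONTOUR COEFFICIENT AND OF THE
# AVERAGING JETS — for a FIXED root and endpoint, the bonds of one direction met by the contour number at most the coordinate distance, so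
# `Σ_u |qJetAt ρ n κ′ u y x| ≤ (n − 1)·n⁻⁴ = O(n⁻³)` per axis and `≤ n⁻⁴·|x − (n•y + ρ)|₁ ≤ 4(n − 1)·n⁻⁴` over all axes (every finite bond set)

HONEST DEPENDENCY (cell records, verbatim): «continuum YM on T⁴ ⇐ BetaPertH ∧ nine spine estimates (0/9 proved); BetaPertH ⇐ (D1) ∧ (D4) ∧
CAP+tail; G-an2-4 gates asym, D1 and NE2/3/4.»  HONEST FRAMING (cell contract, verbatim): «discharging `BetaPertH` makes Bałaban's UV stability
UNCONDITIONAL — a real constructive-QFT result; it is NOT the continuum limit and NOT the Clay problem.»  THIS MODULE DISCHARGES NOTHING of the wall: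
it is [folklore] finite counting over the CLOSED FORM of the contour coefficient `AveragingJetNeedle.gammaCoeff_eq_ite` (leaf-04 lineage) BY NAME — the
bonds `⟨u, u + e_κ′⟩` with `γ(κ′, u; r, x) ≠ 0` have all coordinates but `u_κ′` pinned (to the root's below `κ′`, to the endpoint's above `κ′`) and
`u_κ′` in the half-open integer interval between `r_κ′` and `x_κ′`, so `u ↦ u_κ′` injects them into a set of `|x_κ′ − r_κ′|` integers
(`Finset.card_le_card_of_injOn`, `Int.card_Ico`).  No `def`, no `def … : Prop`, nothing cited, 0 sorry.  Asserts no bound on any word ∕ table ∕ group;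
nothing of Bałaban's.  Root-level binders hW ∕ hR-sockets ∕ hSX-socket ∕ D1Tel ∕ D1Rep — 0 discharged; (K) NOT closed; NOT D1, NOT `BetaPertH`, NOT
continuum, NOT Clay.

ABSOLUTE RULE (cell charter, verbatim): «No internally-minted statement may enter as a cited fact. Every hypothesis is either kernel-proved in this
package or a verbatim quotation of a PUBLISHED theorem with page reference. The manuscript(s) under audit are NOT citable for their own disputed
steps — they are the thing under adjudication; programme-internal (2001/route/tribunal) claims are never citable.»

WHY (an3-g56 (N-1) memo `HOME/b2b-balaban-beta-an3/gen56/NEEDLE-PROFILES.v1.md` 7fa163ef7e91e99e §3 M7 «bond marginal `Σ_{u ∈ B y} |qJet n κ′ u y x| ≤ n·n⁻⁴`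
(and the `qJetAt ρ` twin) — for fixed root and endpoint the bonds met are those of ONE axial contour … This is the letter that makes “sum over the bond
`w` first” cheap in the `qA ⊗ (local)` words»; an1-g37 memo `HOME/b2b-balaban-beta-an1-g37/needle/NEEDLE-PROFILES-an1-v1.md` 980d35f9a4fdf68f §6 M1
«THE located n¹ — bond-index ℓ¹ … `Σ_{(κ,u)} |qJet n κ u Y x| = n⁻⁴·|x − r|₁ ≤ n⁻⁴·4(n−1)`»; owner d1-p2-g9 «NEEDLE-GLUE» p255957: the ghost tables
T4–T7 of `NeedleRowGlue.abs_gN_row_le_of_tables` carry the needle `qA = qAntiAt (ctrHalf n) n` whose BOND variable is the table's running bond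
`b + w`).  The block-`ℓ¹` in the ENDPOINT (`AveragingJetNeedle.sum_B_abs_qJet_le`, leaf-04-g8's rooted `GhostNeedleRootedLetters.sum_B_abs_qJetAt_le`:
`n^{κ′+1}·n⁻⁴`, up to `1` on trunk bonds) is the profile that is `O(1)` per bond; THIS file is the complementary marginal — in the BOND at fixed
endpoint — which is `O(n⁻³)` on every axis: summed once more over the `n⁴` endpoints of a block it returns an3-g52's block total `Σ_b w_b = O(n)`
(`sum_B_sum_bond_abs_qJetAt_le`), i.e. the located `n¹` is exactly «one bond marginal short of a block sum».

CONTENT (all [folklore]; `Site 4 = ℤ⁴`; `B = B6QGQLower276.B (n − 1)` = the block of side `n`; EVERY root `ρ` unless marked «in-block root»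
`hρ : ∀ i, 0 ≤ ρ i ∧ ρ i < n` — the hypothesis every rooted lemma of `GhostStencilRooted` asks, met by `ctrHalf_mem`).
* §1 the contour coefficient: `abs_gammaCoeff_le_indicator` (|γ| ≤ the indicator of the pinned segment), **`sum_abs_gammaCoeff_le`**
  (`Σ_{u ∈ S} |gammaCoeff κ′ u r x| ≤ |x_κ′ − r_κ′|` for every finite bond set `S`), all axes **`sum_sum_abs_gammaCoeff_le`** (`≤ l1 (x − r)`).
* §2 the rooted jet: **`sum_bond_abs_qJetAt_le`** (`Σ_{u ∈ S} |qJetAt ρ n κ′ u y x| ≤ n⁻⁴·|x_κ′ − (n•y + ρ)_κ′|`), in-block root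
  **`sum_bond_abs_qJetAt_le_of_root`** (`≤ (n − 1)·n⁻⁴`), all axes `sum_sum_bond_abs_qJetAt_le` (`≤ n⁻⁴·l1 (x − (n•y + ρ))`) ∕ `…_of_root` (`≤ 4·((n − 1)·n⁻⁴)`),
  the `ρ = 0` twins **`sum_bond_abs_qJet_le`** ∕ `sum_sum_bond_abs_qJet_le` for T6 v1's `GhostStencil.qJet` (`GhostStencilRooted.qJetAt_zero`), the
  whole-lattice forms `summable_bond_abs_qJetAt` ∕ **`tsum_bond_abs_qJetAt_le`** (the jet's bond support lies in the block `B y` by its guard), and the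
  block total `sum_B_sum_bond_abs_qJetAt_le` (`Σ_{x ∈ B y} Σ_{u ∈ S} |qJetAt …| ≤ n⁴·((n − 1)·n⁻⁴)`).
* §3 the stripped kernel: **`sum_bond_abs_qAntiAt_le`** (`Σ_{u ∈ S} |qAntiAt ρ n κ′ u x z a b| ≤ n⁻⁴·(|z_κ′ − (n•blk x + ρ)_κ′| + |x_κ′ − (n•blk z + ρ)_κ′|)`),
  in-block root **`sum_bond_abs_qAntiAt_le_of_root`** (`≤ 2·((n − 1)·n⁻⁴)`), the `ρ = 0` twin `sum_bond_abs_qAnti_le`.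
Unit `b2b-balaban-gan24-formalise-leaf-05` (gen 41), G-an2-4 swarm leaf prover on cross-lane kernel duty; `LEAVES-BFx.md` row (N) ∕ (N-1) letter M7
(journal MINE «NB-MARGINAL»).
-/

noncomputable section

namespace Summit.QuantumFields.BalabanUV.Beta.D1BFx.NeedleBondMarginal

open Finset
open scoped BigOperators
open Literature.MathematicalPhysics.QuantumFieldTheory.Balaban1983to89
open Literature.MathematicalPhysics.QuantumFieldTheory.Balaban1983to89.Beta
open B12Sec2to5 (l1 l1_nonneg)
open B6QGQLower276 (blk B mem_B sum_B)
open ExpKernelCalculus (Site MKer)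
open GhostStencil (gammaCoeff qJet qAnti qAnti_apply mem_block_of_blk_eq)
open Summit.QuantumFields.BalabanUV.Beta.D1BFx.AveragingJetNeedle (gammaCoeff_eq_ite)
open Summit.QuantumFields.BalabanUV.Beta.D1BFx.GhostStencilRooted (qJetAt qAntiAt qAntiAt_apply qJetAt_eq_zero qJetAt_zero qAntiAt_zero)

/-! ## §1 The bond marginal of the contour coefficient -/

/-- [folklore] **THE COEFFICIENT IS DOMINATED BY THE INDICATOR OF ONE PINNED SEGMENT**: `|γ(κ′, u; r, x)| ≤ [u_j = r_j (j < κ′) ∧ u_j = x_j (j > κ′)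
∧ u_κ′ ∈ [r_κ′, x_κ′) ∪ [x_κ′, r_κ′)]` (read off `AveragingJetNeedle.gammaCoeff_eq_ite`). -/
theorem abs_gammaCoeff_le_indicator (κ' : Fin 4) (u r x : Site 4) :
    |gammaCoeff κ' u r x| ≤
      if ((∀ j : Fin 4, (j : ℕ) < κ' → u j = r j) ∧ (∀ j : Fin 4, (κ' : ℕ) < j → u j = x j)) ∧
          u κ' ∈ Finset.Ico (r κ') (x κ') ∪ Finset.Ico (x κ') (r κ') then (1 : ℝ) else 0 := by
  rw [gammaCoeff_eq_ite]
  by_cases hN : (∀ j : Fin 4, (j : ℕ) < κ' → u j = r j) ∧ (∀ j : Fin 4, (κ' : ℕ) < j → u j = x j)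
  · rw [if_pos hN]
    by_cases h1 : r κ' ≤ u κ' ∧ u κ' < x κ'
    · rw [if_pos h1, if_pos ⟨hN, Finset.mem_union.2 (Or.inl (Finset.mem_Ico.2 h1))⟩, abs_one]
    · rw [if_neg h1]
      by_cases h2 : x κ' ≤ u κ' ∧ u κ' < r κ'
      · rw [if_pos h2, if_pos ⟨hN, Finset.mem_union.2 (Or.inr (Finset.mem_Ico.2 h2))⟩, abs_neg, abs_one]
      · rw [if_neg h2, abs_zero]
        split_ifs <;> norm_num
  · rw [if_neg hN, abs_zero, if_neg (fun h => hN h.1)]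

/-- [folklore] **THE BOND MARGINAL OF THE CONTOUR COEFFICIENT**: for a fixed root `r`, endpoint `x` and direction `κ′`, over EVERY finite set `S` of
bond positions, `Σ_{u ∈ S} |γ(κ′, u; r, x)| ≤ |x_κ′ − r_κ′|` — the direction-`κ′` bonds of the axial contour `Γ_{r,x}` form one straight segment of that
many unit steps (`u ↦ u_κ′` is injective on them: the other coordinates are pinned). -/
theorem sum_abs_gammaCoeff_le (κ' : Fin 4) (S : Finset (Site 4)) (r x : Site 4) :
    ∑ u ∈ S, |gammaCoeff κ' u r x| ≤ |((x κ' - r κ' : ℤ) : ℝ)| := by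
  classical
  set T : Finset ℤ := Finset.Ico (r κ') (x κ') ∪ Finset.Ico (x κ') (r κ') with hT
  set P : Site 4 → Prop := fun u =>
    ((∀ j : Fin 4, (j : ℕ) < κ' → u j = r j) ∧ (∀ j : Fin 4, (κ' : ℕ) < j → u j = x j)) ∧ u κ' ∈ T with hP
  have h1 : ∑ u ∈ S, |gammaCoeff κ' u r x| ≤ ∑ u ∈ S, (if P u then (1 : ℝ) else 0) :=
    Finset.sum_le_sum fun u _ => abs_gammaCoeff_le_indicator κ' u r x
  rw [Finset.sum_boole] at h1
  -- the pinned bonds inject into the integer segment by their `κ′`-coordinate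
  have hinj : Set.InjOn (fun u : Site 4 => u κ') ↑(S.filter P) := by
    intro u hu u' hu' h
    rw [Finset.coe_filter] at hu hu'
    funext j
    rcases lt_trichotomy (j : ℕ) (κ' : ℕ) with hj | hj | hj
    · rw [hu.2.1.1 j hj, hu'.2.1.1 j hj]
    · have hjk : j = κ' := Fin.ext hj
      rw [hjk]; exact h
    · rw [hu.2.1.2 j hj, hu'.2.1.2 j hj]
  have hmaps : ∀ u ∈ S.filter P, (fun u : Site 4 => u κ') u ∈ T := fun u hu => (Finset.mem_filter.1 hu).2.2
  have hcard := Finset.card_le_card_of_injOn (fun u : Site 4 => u κ') hmaps hinj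
  have hTc : T.card ≤ (x κ' - r κ').natAbs := by
    calc T.card ≤ (Finset.Ico (r κ') (x κ')).card + (Finset.Ico (x κ') (r κ')).card := Finset.card_union_le _ _
      _ = (x κ' - r κ').toNat + (r κ' - x κ').toNat := by rw [Int.card_Ico, Int.card_Ico]
      _ = (x κ' - r κ').natAbs := by omega
  calc ∑ u ∈ S, |gammaCoeff κ' u r x| ≤ ((S.filter P).card : ℝ) := h1
    _ ≤ (T.card : ℝ) := by exact_mod_cast hcard
    _ ≤ ((x κ' - r κ').natAbs : ℝ) := by exact_mod_cast hTc
    _ = |((x κ' - r κ' : ℤ) : ℝ)| := by rw [Nat.cast_natAbs, Int.cast_abs]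

/-- [folklore] **ALL AXES**: `Σ_{κ′} Σ_{u ∈ S} |γ(κ′, u; r, x)| ≤ |x − r|₁` — an1-g37's located `n¹` identity in inequality form (the axial contour
`Γ_{r,x}` has `|x − r|₁` bonds). -/
theorem sum_sum_abs_gammaCoeff_le (S : Finset (Site 4)) (r x : Site 4) :
    ∑ κ' : Fin 4, ∑ u ∈ S, |gammaCoeff κ' u r x| ≤ l1 (x - r) := by
  unfold l1
  refine Finset.sum_le_sum fun κ' _ => ?_
  have h := sum_abs_gammaCoeff_le κ' S r x
  rw [Pi.sub_apply]
  exact h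

/-! ## §2 The bond marginal of the rooted averaging jet `qJetAt ρ n` (and of T6 v1's `qJet`) -/

variable (ρ : Site 4) (n : ℕ) [NeZero n] (κ' : Fin 4)

/-- [folklore] **THE BOND MARGINAL OF THE ROOTED JET** (every root `ρ`, every finite bond set `S`):
`Σ_{u ∈ S} |qJetAt ρ n κ′ u y x| ≤ n⁻⁴ · |x_κ′ − (n•y + ρ)_κ′|`. -/
theorem sum_bond_abs_qJetAt_le (S : Finset (Site 4)) (y x : Site 4) :
    ∑ u ∈ S, |qJetAt ρ n κ' u y x| ≤ ((n : ℝ) ^ 4)⁻¹ * |((x κ' - ((n : ℤ) • y + ρ) κ' : ℤ) : ℝ)| := by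
  have hn : (0 : ℝ) < n := Nat.cast_pos.mpr (Nat.pos_of_ne_zero (NeZero.ne n))
  have hw : (0 : ℝ) ≤ ((n : ℝ) ^ 4)⁻¹ := inv_nonneg.mpr (pow_pos hn 4).le
  have hpt : ∀ u : Site 4, |qJetAt ρ n κ' u y x| ≤ ((n : ℝ) ^ 4)⁻¹ * |gammaCoeff κ' u ((n : ℤ) • y + ρ) x| := by
    intro u
    unfold qJetAt
    split_ifs
    · rw [abs_mul, abs_inv, abs_of_pos (pow_pos hn 4)]
    · rw [abs_zero]; positivity
  calc ∑ u ∈ S, |qJetAt ρ n κ' u y x| ≤ ∑ u ∈ S, ((n : ℝ) ^ 4)⁻¹ * |gammaCoeff κ' u ((n : ℤ) • y + ρ) x| :=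
        Finset.sum_le_sum fun u _ => hpt u
    _ = ((n : ℝ) ^ 4)⁻¹ * ∑ u ∈ S, |gammaCoeff κ' u ((n : ℤ) • y + ρ) x| := by rw [Finset.mul_sum]
    _ ≤ ((n : ℝ) ^ 4)⁻¹ * |((x κ' - ((n : ℤ) • y + ρ) κ' : ℤ) : ℝ)| :=
        mul_le_mul_of_nonneg_left (sum_abs_gammaCoeff_le κ' S _ x) hw

/-- [folklore] The coordinate distance of a block point to an in-block root of its block is at most `n − 1`; off the block the jet is `0` anyway.
**IN-BLOCK ROOT FORM**: `Σ_{u ∈ S} |qJetAt ρ n κ′ u y x| ≤ (n − 1)·n⁻⁴` — `O(n⁻³)` on every axis. -/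
theorem sum_bond_abs_qJetAt_le_of_root {ρ : Site 4} (hρ : ∀ i : Fin 4, 0 ≤ ρ i ∧ ρ i < n) (S : Finset (Site 4)) (y x : Site 4) :
    ∑ u ∈ S, |qJetAt ρ n κ' u y x| ≤ ((n : ℝ) - 1) * ((n : ℝ) ^ 4)⁻¹ := by
  have hn : (0 : ℝ) < n := Nat.cast_pos.mpr (Nat.pos_of_ne_zero (NeZero.ne n))
  have hw : (0 : ℝ) ≤ ((n : ℝ) ^ 4)⁻¹ := inv_nonneg.mpr (pow_pos hn 4).le
  have hn1 : (1 : ℝ) ≤ n := by exact_mod_cast Nat.one_le_iff_ne_zero.mpr (NeZero.ne n)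
  by_cases hx : blk (n - 1) x = y
  · have hm := mem_block_of_blk_eq n hx κ'
    have hρ' := hρ κ'
    have hz : |x κ' - ((n : ℤ) • y + ρ) κ'| ≤ (n : ℤ) - 1 := by
      rw [Pi.add_apply, abs_le]
      constructor <;> omega
    have h1 : |((x κ' - ((n : ℤ) • y + ρ) κ' : ℤ) : ℝ)| ≤ (n : ℝ) - 1 := by
      rw [← Int.cast_abs]
      exact_mod_cast hz
    calc ∑ u ∈ S, |qJetAt ρ n κ' u y x| ≤ ((n : ℝ) ^ 4)⁻¹ * |((x κ' - ((n : ℤ) • y + ρ) κ' : ℤ) : ℝ)| :=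
          sum_bond_abs_qJetAt_le ρ n κ' S y x
      _ ≤ ((n : ℝ) ^ 4)⁻¹ * ((n : ℝ) - 1) := mul_le_mul_of_nonneg_left h1 hw
      _ = ((n : ℝ) - 1) * ((n : ℝ) ^ 4)⁻¹ := mul_comm _ _
  · have h0 : ∀ u ∈ S, |qJetAt ρ n κ' u y x| = 0 := fun u _ => by
      rw [qJetAt_eq_zero ρ n κ' u (fun h => hx h.1), abs_zero]
    rw [Finset.sum_eq_zero h0]
    exact mul_nonneg (by linarith) hw

/-- [folklore] **THE `ρ = 0` TWIN FOR T6 v1's JET** (`GhostStencilRooted.qJetAt_zero`): `Σ_{u ∈ S} |qJet n κ′ u y x| ≤ (n − 1)·n⁻⁴`. -/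
theorem sum_bond_abs_qJet_le (S : Finset (Site 4)) (y x : Site 4) :
    ∑ u ∈ S, |qJet n κ' u y x| ≤ ((n : ℝ) - 1) * ((n : ℝ) ^ 4)⁻¹ := by
  rw [← qJetAt_zero]
  exact sum_bond_abs_qJetAt_le_of_root n κ'
    (fun i => ⟨le_rfl, by exact_mod_cast Nat.pos_of_ne_zero (NeZero.ne n)⟩) S y x

/-- [folklore] **ALL AXES** (every root): `Σ_{κ′} Σ_{u ∈ S} |qJetAt ρ n κ′ u y x| ≤ n⁻⁴ · |x − (n•y + ρ)|₁`. -/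
theorem sum_sum_bond_abs_qJetAt_le (S : Finset (Site 4)) (y x : Site 4) :
    ∑ κ₁ : Fin 4, ∑ u ∈ S, |qJetAt ρ n κ₁ u y x| ≤ ((n : ℝ) ^ 4)⁻¹ * l1 (x - ((n : ℤ) • y + ρ)) := by
  unfold l1
  rw [Finset.mul_sum]
  refine Finset.sum_le_sum fun κ₁ _ => ?_
  have h := sum_bond_abs_qJetAt_le ρ n κ₁ S y x
  rw [Pi.sub_apply]
  exact h

/-- [folklore] **ALL AXES, IN-BLOCK ROOT**: `Σ_{κ′} Σ_{u ∈ S} |qJetAt ρ n κ′ u y x| ≤ 4·((n − 1)·n⁻⁴)` (an1's `n⁻⁴·4(n − 1)`). -/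
theorem sum_sum_bond_abs_qJetAt_le_of_root {ρ : Site 4} (hρ : ∀ i : Fin 4, 0 ≤ ρ i ∧ ρ i < n) (S : Finset (Site 4)) (y x : Site 4) :
    ∑ κ₁ : Fin 4, ∑ u ∈ S, |qJetAt ρ n κ₁ u y x| ≤ 4 * (((n : ℝ) - 1) * ((n : ℝ) ^ 4)⁻¹) := by
  calc ∑ κ₁ : Fin 4, ∑ u ∈ S, |qJetAt ρ n κ₁ u y x| ≤ ∑ _κ₁ : Fin 4, ((n : ℝ) - 1) * ((n : ℝ) ^ 4)⁻¹ :=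
        Finset.sum_le_sum fun κ₁ _ => sum_bond_abs_qJetAt_le_of_root n κ₁ hρ S y x
    _ = 4 * (((n : ℝ) - 1) * ((n : ℝ) ^ 4)⁻¹) := by simp

/-- [folklore] The `ρ = 0` all-axes twin: `Σ_{κ′} Σ_{u ∈ S} |qJet n κ′ u y x| ≤ 4·((n − 1)·n⁻⁴)`. -/
theorem sum_sum_bond_abs_qJet_le (S : Finset (Site 4)) (y x : Site 4) :
    ∑ κ₁ : Fin 4, ∑ u ∈ S, |qJet n κ₁ u y x| ≤ 4 * (((n : ℝ) - 1) * ((n : ℝ) ^ 4)⁻¹) := by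
  rw [← qJetAt_zero]
  exact sum_sum_bond_abs_qJetAt_le_of_root n (fun i => ⟨le_rfl, by exact_mod_cast Nat.pos_of_ne_zero (NeZero.ne n)⟩) S y x

omit [NeZero n] in
/-- [folklore] The jet's BOND support lies in the block of its coarse label (the guard `blk u = y`), so the bond marginal over the WHOLE lattice is a
finite sum: `u ↦ |qJetAt ρ n κ′ u y x|` is summable … -/
theorem summable_bond_abs_qJetAt (y x : Site 4) : Summable fun u : Site 4 => |qJetAt ρ n κ' u y x| := by
  refine summable_of_ne_finset_zero (s := B (n - 1) y) fun u hu => ?_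
  rw [qJetAt_eq_zero ρ n κ' u (fun h => hu (mem_B.2 h.2)), abs_zero]

omit [NeZero n] in
/-- [folklore] … and equals the block sum: `Σ'_u |qJetAt ρ n κ′ u y x| = Σ_{u ∈ B y} |qJetAt ρ n κ′ u y x|`. -/
theorem tsum_bond_abs_qJetAt_eq (y x : Site 4) :
    ∑' u : Site 4, |qJetAt ρ n κ' u y x| = ∑ u ∈ B (n - 1) y, |qJetAt ρ n κ' u y x| := by
  refine tsum_eq_sum fun u hu => ?_
  rw [qJetAt_eq_zero ρ n κ' u (fun h => hu (mem_B.2 h.2)), abs_zero]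

/-- [folklore] **WHOLE-LATTICE BOND MARGINAL, IN-BLOCK ROOT**: `Σ'_u |qJetAt ρ n κ′ u y x| ≤ (n − 1)·n⁻⁴`. -/
theorem tsum_bond_abs_qJetAt_le {ρ : Site 4} (hρ : ∀ i : Fin 4, 0 ≤ ρ i ∧ ρ i < n) (y x : Site 4) :
    ∑' u : Site 4, |qJetAt ρ n κ' u y x| ≤ ((n : ℝ) - 1) * ((n : ℝ) ^ 4)⁻¹ := by
  rw [tsum_bond_abs_qJetAt_eq]
  exact sum_bond_abs_qJetAt_le_of_root n κ' hρ _ y x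

/-- [folklore] **THE BLOCK TOTAL** (an3-g52's `Σ_b w_b = O(n)` in inequality form): summing the bond marginal over the `n⁴` endpoints of a block,
`Σ_{x ∈ B y} Σ_{u ∈ S} |qJetAt ρ n κ′ u y x| ≤ n⁴·((n − 1)·n⁻⁴)` (`= n − 1`). -/
theorem sum_B_sum_bond_abs_qJetAt_le {ρ : Site 4} (hρ : ∀ i : Fin 4, 0 ≤ ρ i ∧ ρ i < n) (S : Finset (Site 4)) (y : Site 4) :
    ∑ x ∈ B (n - 1) y, ∑ u ∈ S, |qJetAt ρ n κ' u y x| ≤ (n : ℝ) ^ 4 * (((n : ℝ) - 1) * ((n : ℝ) ^ 4)⁻¹) := by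
  have hn1 : n - 1 + 1 = n := Nat.sub_add_cancel (Nat.pos_of_ne_zero (NeZero.ne n))
  calc ∑ x ∈ B (n - 1) y, ∑ u ∈ S, |qJetAt ρ n κ' u y x| ≤ ∑ _x ∈ B (n - 1) y, ((n : ℝ) - 1) * ((n : ℝ) ^ 4)⁻¹ :=
        Finset.sum_le_sum fun x _ => sum_bond_abs_qJetAt_le_of_root n κ' hρ S y x
    _ = (n : ℝ) ^ 4 * (((n : ℝ) - 1) * ((n : ℝ) ^ 4)⁻¹) := by
        rw [sum_B, Finset.sum_const, Finset.card_univ, Fintype.card_fun, Fintype.card_fin, Fintype.card_fin, hn1, nsmul_eq_mul]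
        push_cast
        ring

/-! ## §3 The bond marginal of the stripped kernel `qAntiAt ρ n κ′ u` (and of T6 v1's `qAnti`) -/

/-- [folklore] **THE BOND MARGINAL OF `qAntiAt`** (every root): `Σ_{u ∈ S} |qAntiAt ρ n κ′ u x z a b| ≤ n⁻⁴·(|z_κ′ − (n•blk x + ρ)_κ′| + |x_κ′ − (n•blk z + ρ)_κ′|)`. -/
theorem sum_bond_abs_qAntiAt_le (S : Finset (Site 4)) (x z : Site 4) (a b : Unit) :
    ∑ u ∈ S, |qAntiAt ρ n κ' u x z a b| ≤ ((n : ℝ) ^ 4)⁻¹ *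
      (|((z κ' - ((n : ℤ) • blk (n - 1) x + ρ) κ' : ℤ) : ℝ)| + |((x κ' - ((n : ℤ) • blk (n - 1) z + ρ) κ' : ℤ) : ℝ)|) := by
  calc ∑ u ∈ S, |qAntiAt ρ n κ' u x z a b|
      ≤ ∑ u ∈ S, (|qJetAt ρ n κ' u (blk (n - 1) x) z| + |qJetAt ρ n κ' u (blk (n - 1) z) x|) :=
        Finset.sum_le_sum fun u _ => by rw [qAntiAt_apply]; exact abs_sub _ _
    _ = ∑ u ∈ S, |qJetAt ρ n κ' u (blk (n - 1) x) z| + ∑ u ∈ S, |qJetAt ρ n κ' u (blk (n - 1) z) x| := Finset.sum_add_distrib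
    _ ≤ ((n : ℝ) ^ 4)⁻¹ * |((z κ' - ((n : ℤ) • blk (n - 1) x + ρ) κ' : ℤ) : ℝ)|
          + ((n : ℝ) ^ 4)⁻¹ * |((x κ' - ((n : ℤ) • blk (n - 1) z + ρ) κ' : ℤ) : ℝ)| :=
        add_le_add (sum_bond_abs_qJetAt_le ρ n κ' S _ z) (sum_bond_abs_qJetAt_le ρ n κ' S _ x)
    _ = _ := by ring

/-- [folklore] **IN-BLOCK ROOT FORM**: `Σ_{u ∈ S} |qAntiAt ρ n κ′ u x z a b| ≤ 2·((n − 1)·n⁻⁴)` for every finite bond set `S`. -/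
theorem sum_bond_abs_qAntiAt_le_of_root {ρ : Site 4} (hρ : ∀ i : Fin 4, 0 ≤ ρ i ∧ ρ i < n) (S : Finset (Site 4)) (x z : Site 4)
    (a b : Unit) : ∑ u ∈ S, |qAntiAt ρ n κ' u x z a b| ≤ 2 * (((n : ℝ) - 1) * ((n : ℝ) ^ 4)⁻¹) := by
  calc ∑ u ∈ S, |qAntiAt ρ n κ' u x z a b|
      ≤ ∑ u ∈ S, (|qJetAt ρ n κ' u (blk (n - 1) x) z| + |qJetAt ρ n κ' u (blk (n - 1) z) x|) :=
        Finset.sum_le_sum fun u _ => by rw [qAntiAt_apply]; exact abs_sub _ _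
    _ = ∑ u ∈ S, |qJetAt ρ n κ' u (blk (n - 1) x) z| + ∑ u ∈ S, |qJetAt ρ n κ' u (blk (n - 1) z) x| := Finset.sum_add_distrib
    _ ≤ ((n : ℝ) - 1) * ((n : ℝ) ^ 4)⁻¹ + ((n : ℝ) - 1) * ((n : ℝ) ^ 4)⁻¹ :=
        add_le_add (sum_bond_abs_qJetAt_le_of_root n κ' hρ S _ z) (sum_bond_abs_qJetAt_le_of_root n κ' hρ S _ x)
    _ = 2 * (((n : ℝ) - 1) * ((n : ℝ) ^ 4)⁻¹) := by ring

/-- [folklore] **THE `ρ = 0` TWIN FOR T6 v1's `qAnti`** (`GhostStencilRooted.qAntiAt_zero`): `Σ_{u ∈ S} |qAnti n κ′ u x z a b| ≤ 2·((n − 1)·n⁻⁴)`. -/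
theorem sum_bond_abs_qAnti_le (S : Finset (Site 4)) (x z : Site 4) (a b : Unit) :
    ∑ u ∈ S, |qAnti n κ' u x z a b| ≤ 2 * (((n : ℝ) - 1) * ((n : ℝ) ^ 4)⁻¹) := by
  rw [← qAntiAt_zero]
  exact sum_bond_abs_qAntiAt_le_of_root n κ' (fun i => ⟨le_rfl, by exact_mod_cast Nat.pos_of_ne_zero (NeZero.ne n)⟩) S x z a b

end Summit.QuantumFields.BalabanUV.Beta.D1BFx.NeedleBondMarginal

end
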